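import Summits.HubbardSuperconductivity.HubbardSuperconductivity.Theorems.AnisotropyChordTransferSectorZeroGround
import Summits.HubbardSuperconductivity.HubbardSuperconductivity.Theorems.AnisotropyChordTransferLadderBound

/-!
# Route `AnisotropyChord` / H0 rotor rung, route (1): THEOREM T AT THE `1/|V|` GAP SCALE — a symmetric sector gap
# `≥ C/|V|` with an EXPLICIT finite constant `C = C(Δ, c₀, k)` already gives BEC on the first `k` sectors
# (theory seat `hubbard-h0-rotor-theory-1` g12, memo ROTOR-THEORY-12 §184(j), cell INBOX l.481 item (2a) «(H2-V′)»;
# prover seat `hubbard-h0-rotor-p1` g15)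

THEOREM T in the tree (`transferTheoremEven_holds`, `condensateOnFirstSectors_of_symmetricGap`) is keyed to (H2) = a gap `c₁/L` and
concludes `∀ ε > 0, FirstLinksUpTo Δ ε k`.  For BEC one fixed `ε < c₀` suffices, and then the same induction closes with a gap of
order `1/|V| = 1/L²` provided its constant beats the explicit loss budget of the chain:

* `SymmetricSectorGapInvV Δ C k` — (H2) at the scale `C/|V|` (Temple form, translation-invariant test amplitudes, sectors `|j| ≤ k`);
* **`firstLinksUpTo_of_gapInvV`** — `0 ≤ Δ < 1`, anchor `c₀`, `0 < ε ≤ c₀/2`, gap `≥ C/|V|` on `|j| ≤ k+1` and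
  `(k+1)·Σ_{i≤k} D_i(1−Δ, c₀/4) ≤ C·ε` (`D_i = dSeq`, the chain's loss constants) ⇒ `FirstLinksUpTo Δ ε k`
  ((H3) = `sectorZeroGlobalGroundEven_holds`, (H4), LEMMA E = `ladderExcessBound_holds`, TRANSFER are tree theorems);
* **`condensateOnFirstSectors_of_gapInvV`** — with `ε = c₀/2`: gap `≥ C/|V|` with `2(k+1)·Σ_{i≤k} D_i ≤ C·c₀` ⇒ `CondensateOnFirstSectors Δ k`;
  `condensateOnFirstSectors_xy_of_gapInvV` — the XY point with the tree's KLS anchor (`∃ C₀, ∀ C ≥ C₀, gap ≥ C/|V| ⇒ BEC`).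

The residual of route (1) in its true currency: `γ_sym · |V| ≥ C(Δ, c₀, k)` (the `1/|V|` = SEP scale), not `γ_sym · L → ∞`.
Proof = the landed proof of `transferTheoremEven_holds` with `c₁ := C/L` at each `L` (so `c₁/L = C/|V|`) and the `L`-largeness
`Σ D_i ≤ c₁θL` replaced by the hypothesis on `C`. [conjecture-grade bookkeeping of the theory seat's THEOREM T; all inputs landed]
-/

set_option linter.dupNamespace false
set_option autoImplicit false

noncomputable section

open Finset Filter Topology
open Literature.MathematicalPhysics.QuantumLattice Literature.Probability.LatticeModels
open Summit.HubbardSuperconductivity.HubbardSuperconductivity.Theorems.AnisotropyChord.InsertionEntropy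
open Summit.HubbardSuperconductivity.HubbardSuperconductivity.Theorems.AnisotropyChord.Tower
open Summit.HubbardSuperconductivity.HubbardSuperconductivity.Theorems.AnisotropyChord

namespace Summit.HubbardSuperconductivity.HubbardSuperconductivity.Theorems.AnisotropyChord.Transfer

/-- **(H2) AT THE SCALE `1/|V|`:** eventually in `L`, for `|j| ≤ k`, the Perron amplitude `a` of sector `j` and every
translation-invariant unit real amplitude `φ` of that sector: `(C/|V|)·(1 − ⟨a, φ⟩²) ≤ ⟨φ, Hφ⟩ − E(j)` (`|V| = L²`; the symmetric
`k = 0` sector gap times the volume is `≥ C`; the SEP / Anderson-tower scale).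
[conjecture: theory seat hubbard-h0-rotor-theory-1, cycle 12, memo §184(j) hypothesis (H2-V'); OPEN] -/
def SymmetricSectorGapInvV (Δ C : ℝ) (k : ℕ) : Prop :=
  ∀ᶠ L : ℕ in atTop, ∀ [NeZero L], ∀ j : ℤ, |j| ≤ (k : ℤ) →
    ∀ a φ : TensorIndex (TorusSite 2 L) 2 → ℝ,
      IsPerronSectorGroundAmplitude L Δ (j : ℝ) a →
      cplx L φ ∈ spinZSector (Λ := TorusSite 2 L) 1 (j : ℝ) →
      (∀ v σ, φ (shiftCfg L v σ) = φ σ) → ∑ σ, φ σ ^ 2 = 1 →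
        C / (Fintype.card (TorusSite 2 L) : ℝ) * (1 - (∑ σ, a σ * φ σ) ^ 2) ≤ energyQ L Δ φ - sectorE L Δ (j : ℝ)

/-- a `c₁/L` gap (the tree's (H2)) implies every `C/|V|` gap eventually (`C/L² ≤ c₁/L` for `L ≥ C/c₁`). [folklore] -/
theorem symmetricSectorGapInvV_of_symmetricSectorGap {Δ c₁ C : ℝ} {k : ℕ} (hc₁ : 0 < c₁)
    (h : SymmetricSectorGap Δ c₁ k) : SymmetricSectorGapInvV Δ C k := by
  have hT : ∀ᶠ L : ℕ in atTop, C ≤ c₁ * (L : ℝ) :=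
    (Tendsto.const_mul_atTop hc₁ tendsto_natCast_atTop_atTop).eventually_ge_atTop C
  filter_upwards [h, hT] with L hL hTL
  intro _ j hj a φ ha hφ hinv hunit
  have h1 := hL j hj a φ ha hφ hinv hunit
  have hcard : (Fintype.card (TorusSite 2 L) : ℝ) = (L : ℝ) ^ 2 := by
    rw [Fintype.card_fun, ZMod.card, Fintype.card_fin]; push_cast; ring
  have hLpos : (0 : ℝ) < L := by
    have : (1 : ℝ) ≤ L := by exact_mod_cast Nat.one_le_iff_ne_zero.mpr (NeZero.ne L)
    linarith
  have hov : (∑ σ, a σ * φ σ) ^ 2 ≤ 1 := by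
    have hcs := Finset.sum_mul_sq_le_sq_mul_sq (Finset.univ) a φ
    rw [ha.unit, hunit] at hcs; simpa using hcs
  have hfac : 0 ≤ 1 - (∑ σ, a σ * φ σ) ^ 2 := by linarith
  have hle : C / (Fintype.card (TorusSite 2 L) : ℝ) ≤ c₁ / (L : ℝ) := by
    rw [hcard, div_le_div_iff₀ (by positivity) hLpos]
    nlinarith
  exact le_trans (mul_le_mul_of_nonneg_right hle hfac) h1

variable {L : ℕ}

set_option maxHeartbeats 400000 in
/-- **THEOREM T AT THE `1/|V|` SCALE.**  For `0 ≤ Δ < 1`, anchor `c₀ > 0`, tolerance `0 < ε ≤ c₀/2` and a gap constant `C > 0` with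
`(k+1)·Σ_{i≤k} D_i(1−Δ, c₀/4) ≤ C·ε`: `HalfFillingAnchor Δ c₀` + `SymmetricSectorGapInvV Δ C (k+1)` ⇒ `FirstLinksUpTo Δ ε k`.
The landed proof of `transferTheoremEven_holds` with `c₁ := C/L` at each `L`; (H3), (H4), LEMMA E, TRANSFER from the tree.
[conjecture: theory seat hubbard-h0-rotor-theory-1, cycle 12, memo §184(j) «(H2-V′)» — Lean proof here] -/
theorem firstLinksUpTo_of_gapInvV {Δ c₀ C ε : ℝ} {k : ℕ} (hΔ0 : 0 ≤ Δ) (hΔ1 : Δ < 1) (hc₀ : 0 < c₀) (hC : 0 < C)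
    (hε : 0 < ε) (hεc : ε ≤ c₀ / 2) (hA : HalfFillingAnchor Δ c₀) (hGap : SymmetricSectorGapInvV Δ C (k + 1))
    (hbig : ((k : ℝ) + 1) * (∑ i ∈ range (k + 1), dSeq (1 - Δ) (c₀ / 4) i) ≤ C * ε) :
    FirstLinksUpTo Δ ε k := by
  have hGlob : SectorZeroGlobalGroundEven Δ := sectorZeroGlobalGroundEven_holds (abs_lt.2 ⟨by linarith, hΔ1⟩)
  have hInv : PerronTranslationInvariant Δ := perronTranslationInvariant_holds Δ
  have hLE : LadderExcessBound := ladderExcessBound_holds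
  -- constants
  obtain ⟨ε', hε'pos, hε'le, hε'c, hε'eq⟩ : ∃ ε' : ℝ, 0 < ε' ∧ ε' ≤ ε ∧ ε' ≤ c₀ / 2 ∧ ε' = ε :=
    ⟨ε, hε, le_rfl, hεc, rfl⟩
  obtain ⟨η, hηdef⟩ : ∃ η : ℝ, η = 1 - Δ := ⟨_, rfl⟩
  have hη0 : 0 ≤ η := by rw [hηdef]; linarith
  obtain ⟨ν, hνdef⟩ : ∃ ν : ℝ, ν = c₀ / 4 := ⟨_, rfl⟩
  have hν0 : 0 < ν := by rw [hνdef]; positivity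
  have hk1 : (0 : ℝ) < (k : ℝ) + 1 := by positivity
  obtain ⟨θ, hθdef⟩ : ∃ θ : ℝ, θ = ε' / ((k : ℝ) + 1) := ⟨_, rfl⟩
  have hθ0 : 0 < θ := by rw [hθdef]; positivity
  have hkθ : (k : ℝ) * θ ≤ ε' := by
    rw [hθdef, mul_div_assoc', div_le_iff₀ hk1]; nlinarith [hε'pos.le, hk1]
  obtain ⟨Dsum, hDsum⟩ : ∃ D : ℝ, D = ∑ i ∈ range (k + 1), dSeq η ν i := ⟨_, rfl⟩
  -- largeness of L
  -- the loss budget: `D_i ≤ Dsum ≤ C θ` (hypothesis `hbig`, `θ = ε/(k+1)`)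
  have hDθ : Dsum ≤ C * θ := by
    rw [hθdef, hε'eq, mul_div_assoc', le_div_iff₀ hk1, hDsum, hηdef, hνdef]
    linarith [hbig]
  have hT2 : ∀ᶠ L : ℕ in atTop, (k : ℝ) ^ 2 + k ≤ ν * ((L : ℝ) ^ 2) ^ 2 := by
    have ht : Tendsto (fun L : ℕ => ν * ((L : ℝ) ^ 2) ^ 2) atTop atTop := by
      apply Tendsto.const_mul_atTop hν0
      have h4 : (fun L : ℕ => ((L : ℝ) ^ 2) ^ 2) = fun L : ℕ => (L : ℝ) ^ 4 := by funext L; ring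
      rw [h4]; exact (tendsto_pow_atTop (by norm_num)).comp tendsto_natCast_atTop_atTop
    exact ht.eventually_ge_atTop _
  have hT3 : ∀ᶠ L : ℕ in atTop, 2 * (k + 2) ≤ L := Filter.eventually_ge_atTop _
  filter_upwards [hA, hGap, hT2, hT3] with L hAL hGapL hT2L hT3L
  intro _ j hj a₀ a ha₀ ha
  -- parity of L, read off the sector-0 Perron amplitude
  have hev : Even L := by
    have h0 : IsPerronSectorGroundAmplitude L Δ ((0 : ℕ) : ℝ) a₀ := by rw [Nat.cast_zero]; exact ha₀
    exact even_of_perron_nat h0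
  -- the torus size
  obtain ⟨V, hVdef⟩ : ∃ V : ℝ, V = (Fintype.card (TorusSite 2 L) : ℝ) := ⟨_, rfl⟩
  have hV : V = (L : ℝ) ^ 2 := by
    rw [hVdef, Fintype.card_fun, ZMod.card, Fintype.card_fin]; push_cast; ring
  have hLsq : 2 * (k + 2) ≤ L ^ 2 := le_trans hT3L (Nat.le_self_pow two_ne_zero L)
  have hVk : (2 : ℝ) * (k + 2) ≤ V := by rw [hV]; exact_mod_cast hLsq
  have hk0 : (0 : ℝ) ≤ k := Nat.cast_nonneg k
  have hV2 : (2 : ℝ) ≤ V := by linarith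
  have hVpos : 0 < V := by linarith
  have hVsq : 2 * V ≤ V ^ 2 := by nlinarith
  -- the gap constant at this `L`: `C/|V| = c₁/L` with `c₁ = C/L`
  have hLpos : (0 : ℝ) < L := by
    have : (1 : ℝ) ≤ L := by exact_mod_cast Nat.one_le_iff_ne_zero.mpr (NeZero.ne L)
    linarith
  obtain ⟨c₁, hc₁def⟩ : ∃ c₁ : ℝ, c₁ = C / (L : ℝ) := ⟨_, rfl⟩
  have hc₁ : 0 < c₁ := by rw [hc₁def]; positivity
  have hCV : C / V = c₁ / (L : ℝ) := by rw [hc₁def, hV]; field_simp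
  -- Perron amplitudes in the sectors 0 … k+1 and −1
  have hexN : ∀ i : ℕ, i ≤ k + 1 → ∃ b : TensorIndex (TorusSite 2 L) 2 → ℝ,
      IsPerronSectorGroundAmplitude L Δ (i : ℝ) b := fun i hi => exists_perron_nat ha₀ i (by omega)
  choose! ψ hψ using hexN
  obtain ⟨ψm, hψm⟩ := exists_perron_neg_one ha₀ (by omega)
  have hψ0 : IsPerronSectorGroundAmplitude L Δ 0 (ψ 0) := by
    have := hψ 0 (Nat.zero_le _); rwa [Nat.cast_zero] at this
  -- replace the given amplitudes by the chosen ones (Perron uniqueness)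
  have ea₀ : a₀ = ψ 0 := perron_eq ha₀ hψ0
  have ea : a = ψ j := perron_eq ha (hψ j (by omega))
  rw [ea₀, ea]
  -- the sequences (opaque, with defining equations)
  obtain ⟨f, hf⟩ : ∃ f : ℕ → ℝ, ∀ i, f i =
      Summit.HubbardSuperconductivity.HubbardSuperconductivity.Theorems.AnisotropyChord.Tower.totalSpinSq (ψ i) (i : ℝ) :=
    ⟨_, fun _ => rfl⟩
  obtain ⟨N, hN⟩ : ∃ N : ℕ → ℝ, ∀ i, N i = raiseNormSq (ψ i) := ⟨_, fun _ => rfl⟩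
  obtain ⟨Nt, hNt'⟩ : ∃ Nt : ℕ → ℝ, ∀ i, Nt i = lowerNormSq (ψ i) := ⟨_, fun _ => rfl⟩
  obtain ⟨E, hE⟩ : ∃ E : ℝ → ℝ, ∀ x, E x = sectorE L Δ x := ⟨_, fun _ => rfl⟩
  obtain ⟨ep, hep⟩ : ∃ ep : ℕ → ℝ, ∀ i, ep i = energyQ L Δ (raiseSum (ψ i)) - E i * N i := ⟨_, fun _ => rfl⟩
  -- per-sector facts
  have hNdef : ∀ i, i ≤ k → N i = f i - (i : ℝ) ^ 2 - i := by
    intro i hi; rw [hN, hf]; exact raiseNormSq_eq_totalSpinSq (hψ i (by omega))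
  have hNtdef : ∀ i, Nt i = f i - (i : ℝ) ^ 2 + i := by
    intro i; rw [hNt', hf]; exact lowerNormSq_eq_totalSpinSq (i : ℝ) (ψ i)
  have hftop : ∀ i, i ≤ k + 1 → f i ≤ (V / 2) * (V / 2 + 1) := by
    intro i hi; rw [hf, hVdef]; exact totalSpinSq_le_top (hψ i hi)
  have hNt0 : ∀ i, i ≤ k → 0 ≤ Nt i := by
    intro i _; rw [hNt']; exact Finset.sum_nonneg fun τ _ => sq_nonneg _
  have hN0 : ∀ i, 0 ≤ N i := by
    intro i; rw [hN]; exact Finset.sum_nonneg fun σ _ => sq_nonneg _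
  have hNt : ∀ i, i ≤ k → Nt i ≤ V ^ 2 := by
    intro i hi
    rw [hNtdef i]
    have h1 := hftop i (by omega)
    have hik : (i : ℝ) ≤ k := by exact_mod_cast hi
    have hsq : 0 ≤ (i : ℝ) ^ 2 := sq_nonneg _
    have e : V / 2 * (V / 2 + 1) = V ^ 2 / 4 + V / 2 := by ring
    rw [e] at h1
    linarith
  have hNle : ∀ i, i ≤ k → N i ≤ V ^ 2 := by
    intro i hi
    rw [hNdef i hi]
    have h1 := hftop i (by omega)
    have hi0 : (0 : ℝ) ≤ i := Nat.cast_nonneg _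
    have hsq : 0 ≤ (i : ℝ) ^ 2 := sq_nonneg _
    have e : V / 2 * (V / 2 + 1) = V ^ 2 / 4 + V / 2 := by ring
    rw [e] at h1
    linarith
  -- variational floors and LEMMA E
  have hup : ∀ i, i ≤ k → (E ((i : ℝ) + 1) - E i) * N i ≤ ep i := by
    intro i hi
    have := sectorE_succ_mul_le (hψ i (by omega))
    rw [hep, hE, hE, hN]; linarith
  have hdown : ∀ i, i ≤ k → E ((i : ℝ) - 1) * Nt i ≤ energyQ L Δ (lowerSum (ψ i)) := by
    intro i hi; rw [hE, hNt']; exact sectorE_pred_mul_le (hψ i (by omega))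
  have hLEi : ∀ i, i ≤ k → ep i + (energyQ L Δ (lowerSum (ψ i)) - E i * Nt i) ≤ 4 * η * V := by
    intro i hi
    have := hLE L Δ (i : ℝ) (by linarith) (ψ i) (hψ i (by omega))
    rw [hep, hE, hN, hNt', hηdef, hV]; linarith
  have hE0 : ∀ i, i ≤ k + 1 → E 0 ≤ E i := by
    intro i hi; rw [hE, hE]; exact hGlob L hev (i : ℝ) (ψ i) (hψ i hi)
  have hE0m : E 0 ≤ E (-1) := by rw [hE, hE]; exact hGlob L hev (-1) ψm hψm
  -- the excess bounds
  have hep0 : ep 0 ≤ 4 * η * V := by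
    have h1 := hLEi 0 (Nat.zero_le _)
    have h2 := hdown 0 (Nat.zero_le _)
    have h3 := hNt0 0 (Nat.zero_le _)
    have e : ((0 : ℕ) : ℝ) - 1 = -1 := by norm_num
    rw [e] at h2
    rw [Nat.cast_zero] at h1
    have h4 := mul_le_mul_of_nonneg_right hE0m h3
    linarith
  have hepi : ∀ i, 1 ≤ i → i ≤ k → 0 < N (i - 1) → ep i ≤ 4 * η * V + ep (i - 1) / N (i - 1) * Nt i := by
    intro i hi1 hik hNp
    have h1 := hLEi i hik
    have h2 := hdown i hik
    have h3 := hup (i - 1) (by omega)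
    have ecast : (((i - 1 : ℕ) : ℝ)) = (i : ℝ) - 1 := by rw [Nat.cast_sub hi1]; simp
    have ecast' : (((i - 1 : ℕ) : ℝ)) + 1 = (i : ℝ) := by rw [ecast]; ring
    rw [ecast'] at h3
    rw [← ecast] at h2
    have h4 : E (i : ℝ) - E (((i - 1 : ℕ) : ℝ)) ≤ ep (i - 1) / N (i - 1) := by
      rw [le_div_iff₀ hNp]; linarith
    have h5 := mul_le_mul_of_nonneg_right h4 (hNt0 i hik)
    have e5 : (E (i : ℝ) - E (((i - 1 : ℕ) : ℝ))) * Nt i = E (i : ℝ) * Nt i - E (((i - 1 : ℕ) : ℝ)) * Nt i := by ring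
    rw [e5] at h5
    linarith
  -- the link inequality
  have hlink : ∀ i, i < k → (∀ m, m ≤ i → 0 < N m) →
      f i - (L : ℝ) / c₁ * (ep i + N i * ∑ m ∈ range i, ep m / N m) ≤ f (i + 1) := by
    intro i hik hNp
    have hψi := hψ i (by omega)
    have hψi1 : IsPerronSectorGroundAmplitude L Δ ((i : ℝ) + 1) (ψ (i + 1)) := by
      have := hψ (i + 1) (by omega); push_cast at this; exact this
    -- the gap hypothesis at the sector i+1
    have hgap : ∀ φ : TensorIndex (TorusSite 2 L) 2 → ℝ,
        cplx L φ ∈ spinZSector (Λ := TorusSite 2 L) 1 ((i : ℝ) + 1) → (∀ v σ, φ (shiftCfg L v σ) = φ σ) →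
        ∑ σ, φ σ ^ 2 = 1 →
          c₁ / (L : ℝ) * (1 - (∑ σ, ψ (i + 1) σ * φ σ) ^ 2) ≤ energyQ L Δ φ - sectorE L Δ ((i : ℝ) + 1) := by
      intro φ hφ hφinv hφunit
      have ecast : (((i + 1 : ℕ) : ℤ) : ℝ) = (i : ℝ) + 1 := by push_cast; ring
      have habs : |((i + 1 : ℕ) : ℤ)| ≤ ((k + 1 : ℕ) : ℤ) := by
        rw [abs_of_nonneg (by positivity)]; exact_mod_cast (by omega : i + 1 ≤ k + 1)
      have h := hGapL ((i + 1 : ℕ) : ℤ) habs (ψ (i + 1)) φ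
        (by rw [ecast]; exact hψi1) (by rw [ecast]; exact hφ) hφinv hφunit
      rw [ecast, ← hVdef, hCV] at h; exact h
    have hone := totalSpinSq_succ_ge_of_gap hc₁ hψi hψi1 hgap (hInv L (i : ℝ) (ψ i) hψi)
      (by have := hNp i le_rfl; rwa [hN] at this)
    -- staircase: E i − E(i+1) ≤ E i − E 0 ≤ Σ_{m<i} ep m / N m
    have hstair : E (i : ℝ) - E 0 ≤ ∑ m ∈ range i, ep m / N m := by
      have htel : ∑ m ∈ range i, (E ((m : ℝ) + 1) - E m) = E (i : ℝ) - E 0 := by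
        have := Finset.sum_range_sub (fun m => E (m : ℝ)) i
        simp only [Nat.cast_succ, Nat.cast_zero] at this
        exact this
      rw [← htel]
      apply Finset.sum_le_sum
      intro m hm
      have hmi : m ≤ i := (mem_range.mp hm).le
      rw [le_div_iff₀ (hNp m hmi)]
      exact hup m (by omega)
    have hE01 : E 0 ≤ E ((i : ℝ) + 1) := by
      have := hE0 (i + 1) (by omega); push_cast at this; exact this
    have hNi := hN0 i
    have hbound : energyQ L Δ (raiseSum (ψ i)) - sectorE L Δ ((i : ℝ) + 1) * raiseNormSq (ψ i)
        ≤ ep i + N i * ∑ m ∈ range i, ep m / N m := by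
      have e1 : energyQ L Δ (raiseSum (ψ i)) = ep i + E i * N i := by rw [hep]; ring
      rw [e1, ← hE, ← hN]
      have h2 : (E (i : ℝ) - E ((i : ℝ) + 1)) * N i ≤ (E (i : ℝ) - E 0) * N i :=
        mul_le_mul_of_nonneg_right (by linarith) hNi
      have h3 : (E (i : ℝ) - E 0) * N i ≤ N i * ∑ m ∈ range i, ep m / N m := by
        rw [mul_comm]; exact mul_le_mul_of_nonneg_left hstair hNi
      linarith
    have hL0 : 0 ≤ (L : ℝ) / c₁ := div_nonneg (Nat.cast_nonneg _) hc₁.le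
    have h4 := mul_le_mul_of_nonneg_left hbound hL0
    rw [hf, hf]
    push_cast
    linarith
  -- floor and largeness
  have hf0 : c₀ * V ^ 2 ≤ f 0 := by
    have h := hAL (ψ 0) hψ0
    have e0 : condensateDensity (ψ 0) = lowerNormSq (ψ 0) / V ^ 2 := by rw [hVdef]; rfl
    rw [e0, le_div_iff₀ (by positivity)] at h
    have : f 0 = lowerNormSq (ψ 0) := by
      rw [hf]
      unfold Summit.HubbardSuperconductivity.HubbardSuperconductivity.Theorems.AnisotropyChord.Tower.totalSpinSq
      push_cast; ring
    rw [this]; exact h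
  have hfloor : ∀ i, i ≤ k → ν * V ^ 2 ≤ f 0 - (i : ℝ) * θ * V ^ 2 - (i : ℝ) ^ 2 - i := by
    intro i hi
    have hik : (i : ℝ) ≤ k := by exact_mod_cast hi
    have hi0 : (0 : ℝ) ≤ i := Nat.cast_nonneg _
    have h1 : (i : ℝ) * θ ≤ ε' := le_trans (mul_le_mul_of_nonneg_right hik hθ0.le) hkθ
    have h2a : (i : ℝ) ^ 2 ≤ (k : ℝ) ^ 2 := pow_le_pow_left₀ hi0 hik 2
    have h3 : (k : ℝ) ^ 2 + k ≤ ν * V ^ 2 := by rw [hV]; exact hT2L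
    have hV4 : 0 ≤ V ^ 2 := sq_nonneg _
    have h5 := mul_le_mul_of_nonneg_right h1 hV4
    have h6 := mul_le_mul_of_nonneg_right hε'c hV4
    rw [hνdef] at h3 ⊢
    linarith
  have hLr : ∀ i, i ≤ k → (L : ℝ) * V * dSeq η ν i ≤ c₁ * θ * V ^ 2 := by
    intro i hi
    have h1 : dSeq η ν i ≤ Dsum := by
      rw [hDsum]
      exact Finset.single_le_sum (f := fun m => dSeq η ν m) (fun m _ => dSeq_nonneg hη0 hν0 m)
        (mem_range.mpr (by omega))
    have h2 : dSeq η ν i ≤ C * θ := le_trans h1 hDθ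
    have e : c₁ * θ * V ^ 2 = (L : ℝ) * V * (C * θ) := by rw [hc₁def, hV]; field_simp
    rw [e]
    exact mul_le_mul_of_nonneg_left h2 (by positivity)
  -- the abstract induction
  have hchain := abstract_chain k hη0 hν0 hc₁ hθ0 hVpos (Nat.cast_nonneg L) f N Nt ep hNdef hNt hNt0 hNle hep0 hepi
    hlink hfloor hLr j hj
  have hjθ : (j : ℝ) * θ ≤ ε' :=
    le_trans (mul_le_mul_of_nonneg_right (by exact_mod_cast hj : (j : ℝ) ≤ k) hθ0.le) hkθ
  have hV4 : 0 ≤ V ^ 2 := sq_nonneg _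
  have h1 := hchain.1
  have e0 : Summit.HubbardSuperconductivity.HubbardSuperconductivity.Theorems.AnisotropyChord.Tower.totalSpinSq (ψ 0) 0 = f 0 := by
    rw [hf, Nat.cast_zero]
  rw [e0, ← hf j, ← hVdef]
  have h7 := mul_le_mul_of_nonneg_right hjθ hV4
  have h8 := mul_le_mul_of_nonneg_right hε'le hV4
  linarith


/-- **BEC AT THE `1/|V|` SCALE:** `0 ≤ Δ < 1`, anchor `c₀`, and a symmetric sector gap `≥ C/|V|` on the sectors `|j| ≤ k+1` with
`2(k+1)·Σ_{i≤k} D_i(1−Δ, c₀/4) ≤ C·c₀` ⇒ `CondensateOnFirstSectors Δ k`.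
[conjecture: theory seat hubbard-h0-rotor-theory-1, cycle 12, memo §184(j) «(H2-V′) ⇒ BEC»; Lean proof here] -/
theorem condensateOnFirstSectors_of_gapInvV {Δ c₀ C : ℝ} {k : ℕ} (hΔ0 : 0 ≤ Δ) (hΔ1 : Δ < 1) (hc₀ : 0 < c₀) (hC : 0 < C)
    (hA : HalfFillingAnchor Δ c₀) (hGap : SymmetricSectorGapInvV Δ C (k + 1))
    (hbig : 2 * ((k : ℝ) + 1) * (∑ i ∈ range (k + 1), dSeq (1 - Δ) (c₀ / 4) i) ≤ C * c₀) :
    CondensateOnFirstSectors Δ k := by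
  have hlinks : FirstLinksUpTo Δ (c₀ / 2) k :=
    firstLinksUpTo_of_gapInvV hΔ0 hΔ1 hc₀ hC (by linarith) le_rfl hA hGap (by linarith)
  refine firstLinksGiveCondensate_holds Δ (c₀ / 2) c₀ k (by linarith) (by linarith) hA ?_ ?_ hlinks
  · exact Filter.Eventually.of_forall fun L _ hL => exists_perron_zero_of_even Δ hL
  · exact Filter.Eventually.of_forall fun L _ hL j a ha => hL (even_of_perron_nat ha)

/-- **XY point (hard-core bosons on `(ℤ/L)²`, anchor = KLS in the tree):** there is an explicit threshold `C₀` (from the KLS constant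
and the chain's loss constants at `Δ = 0`) such that a symmetric sector gap `≥ C/|V|`, `C ≥ C₀`, on the sectors `|j| ≤ k+1` gives BEC
at `N = L²/2 + j`, `j ≤ k`. [conjecture: theory seat hubbard-h0-rotor-theory-1, cycle 12 — (H2-V′) at the XY point; Lean proof here] -/
theorem condensateOnFirstSectors_xy_of_gapInvV (k : ℕ) :
    ∃ C₀ > (0 : ℝ), ∀ C : ℝ, C₀ ≤ C → SymmetricSectorGapInvV 0 C (k + 1) → CondensateOnFirstSectors 0 k := by
  obtain ⟨c₀, hc₀, hA⟩ := halfFillingAnchor_xy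
  set D : ℝ := ∑ i ∈ range (k + 1), dSeq (1 - 0) (c₀ / 4) i with hD
  have hD0 : 0 ≤ D := Finset.sum_nonneg fun i _ => dSeq_nonneg (by norm_num) (by positivity) i
  refine ⟨2 * ((k : ℝ) + 1) * D / c₀ + 1, by positivity, fun C hC hGap => ?_⟩
  have hCpos : 0 < C := lt_of_lt_of_le (by positivity) hC
  refine condensateOnFirstSectors_of_gapInvV le_rfl one_pos hc₀ hCpos hA hGap ?_
  have h1 : 2 * ((k : ℝ) + 1) * D / c₀ ≤ C := by linarith
  rw [div_le_iff₀ hc₀] at h1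
  rw [← hD]
  linarith

end Summit.HubbardSuperconductivity.HubbardSuperconductivity.Theorems.AnisotropyChord.Transfer
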